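import Literature.NumberTheory.EllipticCurves.NewformSymmSquareRSContinuation
import Literature.NumberTheory.EllipticCurves.LFunctionCoefficientBound
import Literature.Analysis.Complex.RademacherPhragmenLindelof
import HarnessLib

/-!
# The Phragmén–Lindelöf upper bound for the Petersson norm of the newform of a semistable
# elliptic curve: `(f, f)_{Γ₀(N)} ≤ C · N · (1 + log N)⁵` for squarefree `N`

Topic `NumberTheory/Automorphic`; a proofs-only companion (theorems only: no definition, no named
fact) of `ShimuraCurveRibetTakahashi.lean` and `ShimuraCurveRibetTakahashiPeterssonProofs.lean`,
for the named fact `murty_petersson_newform_upper_bound` (`Re (f,f) ≤ C · N · log N` for the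
newform of every elliptic curve over `ℚ`; Murty 1999, §2; Pasten 2024, p. 49). That statement —
exponent `1` of `log N` — is equivalent to `L^{naive}(Sym² f_E, 1) ≪ log N_E`
(`murty_petersson_newform_upper_bound_iff_symmSqLOne`) and is not proved in the literature; the
printed proof behind it ([MaiMurty1994], §2) is the **Phragmén–Lindelöf convexity argument** for
the symmetric-square `L`-function in the level aspect and gives `(f,f) ≪ N (log N)³`. This file
PROVES that convexity bound, in the tree, for every SQUAREFREE level (every semistable elliptic
curve — the case of the `abc` applications, Frey curves being semistable):

* `exists_petersson_le_mul_log_pow_of_squarefree` — **there is an absolute `C > 0` with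
  `Re (f, f)_{Γ₀(N)} ≤ C · N · (1 + log N)⁵` for every squarefree `N`, every elliptic curve `E/ℚ`
  and every `f ∈ S₂(Γ₀(N))` with `IsNewformOf E f`** (`C = 324 · (7/3)⁴ · e · 4⁵`);
* `exists_petersson_le_mul_log_pow_five_of_squarefree` — the same as `≤ C · N · (log N)⁵` for
  `N ≥ 3` (the shape of the named fact, exponent `5`);
* `exists_log_petersson_le_of_squarefree` — the logarithmic form
  `log Re (f,f) ≤ log N + 5 log log N + C` (`N ≥ 3`), which is how the bound is used in
  [PastenShimura2024], p. 49 ("`2 log ‖f‖ ≤ log N + O(log log N)`") and in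
  [MurtyCongruencePrimes1999], §2 (`log (f,f) < (1 + ε) log N`).

## The printed proof and the proof here

[MaiMurty1994], §2: Rademacher's Phragmén–Lindelöf theorem (Proposition: for an Euler product of
degree `d` with an entire continuation and a functional equation of conductor `A`,
`|L(σ+it)| ≪ (A(|t|+2)^d)^{(1−σ)/2} (log (A(|t|+2)^d))^d` on `0 ≤ σ ≤ 1`), applied to
`L(s, Sym² f)` — entire with `log A = O(log N)` by Shimura 1975 — gives
"`L(1, Sym²(f)) = O((log N)³)`", and the Rankin–Selberg display
`L(1, Sym²(f)) = 288π³ ∏_{p²∣N}(1 − p⁻²) ⟨f,f⟩/N` turns it into the Proposition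
`log⟨f,f⟩ = O(log N)`. The tree does not have Shimura's holomorphy of `L(s, Sym² f)`, but it
has the complete Rankin–Selberg theory of the `SL₂(ℤ)`-trace `G_f` of `|f|²y²` (Rankin 1939):
with `V = ∫_𝒟 G_f dμ = Re (f,f)` (`peterssonProduct_self_re_eq_integral_rsTrace`) the completed
trace zeta function `Z_f(s) = s(s−1) ∫_𝒟 G_f E₀*(·,s) dμ + V/2` is entire (`differentiable_J₀`),
satisfies `Z_f(1−s) = Z_f(s)` (`J₀_one_sub`), `Z_f(1) = V/2`, and the uniform bound
`|Z_f(s)| ≤ (|s(s−1)| Q (1 + N/4π)⁴ + ½) V` on `−1/2 ≤ Re s ≤ 7/2` (`exists_norm_J₀_le_uniform`),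
and for squarefree `N` and a newform `f`, on `Re s > 1` (`IsNewform0.traceZeta_eq_of_squarefree`),

  `Z_f(s) = s(s−1) π^{-s}Γ(s)ζ(2s)Γ(s+1)(4π/N)^{-(s+1)} · (N⁻¹Σ_{c∣N} c^{-s}) · Σₙ|aₙ|²n^{-(s+1)}`,

i.e. `Z_f` is the completed Rankin–Selberg `L`-function `Λ(f × f̄, s)` times `s(s−1)`. The proof
here is the convexity argument for `Z_f` between the lines `Re s = 1 + δ` and `Re s = −δ`,
`δ = 1/(2 + log N)`, evaluated at the single point `s = 1`:
1. (§1, arithmetic input) Hasse's bound `|a_{p^e}(E)| ≤ (e+1)p^{e/2}` (tree,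
   `WeierstrassCurve.abs_LFunction_prime_pow_le`, Manin's elementary proof) and the Euler product
   of `Σ|aₙ|²n^{-w}` (tree) give `Σₙ|aₙ|²n^{-(2+δ)} ≤ ζ(1+δ)⁴`
   (`IsNewformOf.tsum_normSq_cuspCoeff_div_rpow_le`; `Σ(e+1)²yᵉ ≤ Σ binom(e+3,3) yᵉ = (1−y)⁻⁴`);
2. (§2) on `Re s = 1 + δ`: `|Γ(s)| ≤ 1`, `|Γ(s+1)| ≤ |s|`, `|ζ(2s)| ≤ 2 + |s|`,
   `|(4π/N)^{-(s+1)}| ≤ N^{2+δ}`, `|Σ_{c∣N}c^{-s}| ≤ ζ(1+δ)`, whence `|Z_f(s)| ≤ 2N^{1+δ}ζ(1+δ)⁵|s+2|⁴`;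
   by the functional equation the same holds on `Re s = −δ` up to the factor `(7/3)⁴`
   (`|3 − s| ≤ (7/3)|s + 2|`);
3. (§3) the uniform bound makes `Z_f` of finite order in the strip, so Rademacher's theorem
   (`rademacher_phragmenLindelof_of_finiteOrder`, tree) gives
   `V/2 = Z_f(1) ≤ 81 · (7/3)⁴ · 2N^{1+δ}ζ(1+δ)⁵`, and `N^δ ≤ e`, `ζ(1+δ) ≤ 2 + 1/δ = 4 + log N`.
The exponent `5` instead of `3` is the price of bounding `ζ(2s) (Σ_{c∣N}c^{-s}) Σ|aₙ|²n^{-s-1}`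
factor by factor on the right-hand line instead of `ζ(s) L(Sym² f, s+1)` (the pole of the
Rankin–Selberg series at the edge costs `ζ(1+δ)`, the divisor sum another `ζ(1+δ)`); the
restriction to squarefree `N` is that of the tree's dictionary between `G_f` and `Σ|aₙ|²n^{-w}`
(Atkin–Lehner at every cusp). Neither affects the use made of the bound (`O(log log N)` slack).
All inputs are theorems of the tree and Mathlib; the results below depend on no named fact.

## References

* [MaiMurty1994] L. Mai, M. R. Murty, *The Phragmén–Lindelöf theorem and modular elliptic
  curves*, Contemp. Math. 166 (1994), 335–340, §2: Rademacher's Proposition; "Hence, by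
  Rademacher's version of the Phragmén–Lindelöf, `L(1, Sym²(f)) = O((log N)³)`"; the
  Rankin–Selberg display; "Proposition. `log⟨f,f⟩ = O(log N)`" (read in the authors' preprint).
* [Rademacher1959] H. Rademacher, Math. Z. 72 (1959), 192–204, Thm. 2.
* [Rankin1939] R. A. Rankin, Proc. Cambridge Philos. Soc. 35 (1939), 357–372, §4.4.
* [MurtyCongruencePrimes1999] M. R. Murty, *Bounds for congruence primes*, Proc. Sympos. Pure
  Math. 66.1 (1999), §2 ("`(f,f) ≤ c₂ N log N`", citing [MM]).
* [PastenShimura2024] H. Pasten, *Shimura curves and the abc conjecture*, J. Number Theory 254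
  (2024) = arXiv:1705.09251, §16, p. 49 ("`‖f‖² ≪ N log N` which gives
  `2 log ‖f‖ ≤ log N + O(log log N)`").
* J. H. Silverman, *The Arithmetic of Elliptic Curves*, Thm. V.1.1 (Hasse).
-/

noncomputable section

open scoped Real Topology MatrixGroups ModularForm
open Filter Complex Set MeasureTheory CongruenceSubgroup

namespace Literature.NumberTheory.Automorphic

open Literature.NumberTheory.EllipticCurves.ModularForms
open Literature.NumberTheory.LFunctions

/-! ### 1. The arithmetic input on `Re s = 1 + δ`: `Σ |aₙ|² n^{-(2+δ)} ≤ ζ(1+δ)⁴` (Hasse) -/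

section Arithmetic

/-- `(e + 1)² ≤ binom(e + 3, 3)` for every `e ≥ 0` (`6(e+1) ≤ (e+2)(e+3)`). [folklore] -/
theorem sq_succ_le_choose_three (e : ℕ) : (e + 1) ^ 2 ≤ (e + 3).choose 3 := by
  have h3 := Nat.add_one_mul_choose_eq (e + 2) 2
  have h2 := Nat.add_one_mul_choose_eq (e + 1) 1
  simp only [Nat.choose_one_right] at h2
  norm_num [show e + 2 + 1 = e + 3 by ring, show e + 1 + 1 = e + 2 by ring] at h2 h3
  -- `2 · C(e+2,2) = (e+2)(e+1)`, `3 · C(e+3,3) = (e+3) C(e+2,2)`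
  have key : (e + 3).choose 3 * 6 = (e + 3) * ((e + 2) * (e + 1)) := by
    calc (e + 3).choose 3 * 6 = ((e + 3).choose 3 * 3) * 2 := by ring
      _ = ((e + 3) * (e + 2).choose 2) * 2 := by rw [h3]
      _ = (e + 3) * ((e + 2).choose 2 * 2) := by ring
      _ = (e + 3) * ((e + 2) * (e + 1)) := by rw [← h2]
  have he : e ≤ e ^ 3 := Nat.le_self_pow (by norm_num) e
  have h6 : (e + 1) ^ 2 * 6 ≤ (e + 3).choose 3 * 6 := by rw [key]; nlinarith [he]
  exact Nat.le_of_mul_le_mul_right h6 (by norm_num)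

/-- `Σ_e (e+1)² yᵉ ≤ (1 − y)⁻⁴` for `0 ≤ y < 1` (termwise `(e+1)² ≤ binom(e+3,3)` and
`Σ binom(e+3,3) yᵉ = (1−y)⁻⁴`). [folklore] -/
theorem tsum_sq_succ_mul_pow_le {y : ℝ} (hy0 : 0 ≤ y) (hy1 : y < 1) :
    ∑' e : ℕ, ((e : ℝ) + 1) ^ 2 * y ^ e ≤ 1 / (1 - y) ^ 4 := by
  have hy : ‖y‖ < 1 := by rwa [Real.norm_of_nonneg hy0]
  have hG : HasSum (fun e : ℕ ↦ ((e + 3).choose 3 : ℝ) * y ^ e) (1 / (1 - y) ^ 4) := by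
    simpa using hasSum_choose_mul_geometric_of_norm_lt_one 3 hy
  have hle : ∀ e : ℕ, ((e : ℝ) + 1) ^ 2 * y ^ e ≤ ((e + 3).choose 3 : ℝ) * y ^ e := fun e ↦ by
    have h : ((e : ℝ) + 1) ^ 2 ≤ ((e + 3).choose 3 : ℝ) := by
      exact_mod_cast sq_succ_le_choose_three e
    exact mul_le_mul_of_nonneg_right h (pow_nonneg hy0 e)
  have hS : Summable fun e : ℕ ↦ ((e : ℝ) + 1) ^ 2 * y ^ e :=
    Summable.of_nonneg_of_le (fun e ↦ by positivity) hle hG.summable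
  exact hasSum_le hle hS.hasSum hG

variable {N : ℕ} [NeZero N] {W : WeierstrassCurve ℚ} [W.IsElliptic] {f : CuspForm (Gamma0 N) 2}

/-- **Hasse's bound for the newform of `E/ℚ` at prime powers**: `‖a_{p^e}(f)‖² ≤ (e+1)² pᵉ`
(`aₙ(f) = aₙ(E)`, the tree's `WeierstrassCurve.abs_LFunction_prime_pow_le`). A private copy of
`IsNewformOf.norm_cuspCoeff_prime_pow_sq_le` of `RankinSymmSquareTwistComparison.lean` (same
statement; not imported here to keep the import cone of this file small). [folklore] -/
private theorem hasse_normSq_cuspCoeff_prime_pow_le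
    (hf : IsNewformOf W f) {p : ℕ} (hp : p.Prime) (e : ℕ) :
    ‖cuspCoeff f (p ^ e)‖ ^ 2 ≤ ((e : ℝ) + 1) ^ 2 * (p : ℝ) ^ e := by
  have h := W.abs_LFunction_prime_pow_le hp e
  have hnorm : ‖cuspCoeff f (p ^ e)‖ = |(W.LFunction (p ^ e) : ℝ)| := by
    rw [hf.2 (p ^ e), Complex.norm_intCast]
  have hp0 : (0 : ℝ) ≤ p := Nat.cast_nonneg p
  have hsq : (Real.sqrt p ^ e) ^ 2 = (p : ℝ) ^ e := by
    rw [← pow_mul, mul_comm, pow_mul, Real.sq_sqrt hp0]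
  have h0 : 0 ≤ ((e : ℝ) + 1) * Real.sqrt p ^ e := by positivity
  calc ‖cuspCoeff f (p ^ e)‖ ^ 2 = |(W.LFunction (p ^ e) : ℝ)| ^ 2 := by rw [hnorm]
    _ ≤ (((e : ℝ) + 1) * Real.sqrt p ^ e) ^ 2 :=
        pow_le_pow_left₀ (abs_nonneg _) h 2
    _ = ((e : ℝ) + 1) ^ 2 * (p : ℝ) ^ e := by rw [mul_pow, hsq]

/-- **The local factor of `Σ |aₙ|² n^{-w}` at `p` is at most `(1 − p^{1−w})⁻⁴`** for the newform of
an elliptic curve over `ℚ` and real `w > 2` (Hasse at prime powers and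
`Σ (e+1)² yᵉ ≤ (1−y)⁻⁴`, `y = p^{1−w}`). [folklore] -/
theorem _root_.Literature.NumberTheory.EllipticCurves.ModularForms.IsNewformOf.tsum_normSq_cuspCoeff_prime_pow_le
    (hf : IsNewformOf W f) {w : ℝ} (hw : 2 < w) {p : ℕ} (hp : p.Prime) :
    ∑' e : ℕ, ‖cuspCoeff f (p ^ e)‖ ^ 2 * ((p : ℝ) ^ (-w)) ^ e ≤
      1 / (1 - (p : ℝ) ^ (-(w - 1))) ^ 4 := by
  have hp1 : (1 : ℝ) < p := by exact_mod_cast hp.one_lt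
  have hp0 : (0 : ℝ) < p := by linarith
  set y : ℝ := (p : ℝ) ^ (-(w - 1)) with hy
  have hy0 : 0 ≤ y := Real.rpow_nonneg hp0.le _
  have hy1 : y < 1 := Real.rpow_lt_one_of_one_lt_of_neg hp1 (by linarith)
  -- `(p^{-w})^e · p^e = y^e`
  have hpow : ∀ e : ℕ, ((p : ℝ) ^ (-w)) ^ e * (p : ℝ) ^ e = y ^ e := by
    intro e
    rw [← mul_pow]
    congr 1
    rw [hy, show -(w - 1) = -w + 1 by ring, Real.rpow_add hp0, Real.rpow_one]
  have hle : ∀ e : ℕ, ‖cuspCoeff f (p ^ e)‖ ^ 2 * ((p : ℝ) ^ (-w)) ^ e ≤ ((e : ℝ) + 1) ^ 2 * y ^ e := by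
    intro e
    calc ‖cuspCoeff f (p ^ e)‖ ^ 2 * ((p : ℝ) ^ (-w)) ^ e
        ≤ (((e : ℝ) + 1) ^ 2 * (p : ℝ) ^ e) * ((p : ℝ) ^ (-w)) ^ e :=
          mul_le_mul_of_nonneg_right (hasse_normSq_cuspCoeff_prime_pow_le hf hp e) (by positivity)
      _ = ((e : ℝ) + 1) ^ 2 * y ^ e := by rw [← hpow e]; ring
  have hS : Summable fun e : ℕ ↦ ‖cuspCoeff f (p ^ e)‖ ^ 2 * ((p : ℝ) ^ (-w)) ^ e :=
    summable_normSq_cuspCoeff_prime_pow_mul f hw hp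
  have hT : Summable fun e : ℕ ↦ ((e : ℝ) + 1) ^ 2 * y ^ e := by
    have hy' : ‖y‖ < 1 := by rwa [Real.norm_of_nonneg hy0]
    have hG := (hasSum_choose_mul_geometric_of_norm_lt_one 3 hy').summable
    refine Summable.of_nonneg_of_le (fun e ↦ by positivity) (fun e ↦ ?_) hG
    have h : ((e : ℝ) + 1) ^ 2 ≤ ((e + 3).choose 3 : ℝ) := by
      exact_mod_cast sq_succ_le_choose_three e
    exact mul_le_mul_of_nonneg_right h (pow_nonneg hy0 e)
  exact (Summable.tsum_le_tsum hle hS hT).trans (tsum_sq_succ_mul_pow_le hy0 hy1)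

/-- **`Σₙ |aₙ(f)|² n^{-w} ≤ ζ(w − 1)⁴`** for the newform `f` of an elliptic curve over `ℚ` and real
`w > 2`, with `ζ(x) = Σ_{n ≥ 1} n^{-x}` the real series: the Euler product
`Σ |aₙ|² n^{-w} = ∏_p Σ_e |a_{p^e}|² p^{-ew}` (`IsNewform0.hasProd_tsum_normSq_cuspCoeff_prime_pow`),
the local bound `(1 − p^{1−w})⁻⁴` and `∏_p (1 − p^{-(w−1)})⁻¹ = ζ(w−1)`
(`hasProd_one_sub_prime_rpow_neg_inv`). This is the Ramanujan-type (here: Hasse) input of the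
Phragmén–Lindelöf argument on the line of absolute convergence `Re s = 1 + δ`, where an Euler
product of degree `d` with unitary local roots is bounded by `ζ(1+δ)^d` (Mai–Murty 1994, §2,
hypothesis (i)–(ii) of Rademacher's Proposition; here `d = 4` for `f × f̄`).
[cite: MaiMurty1994, §2 (Rademacher's Proposition, the line σ = 1 + δ)] -/
theorem _root_.Literature.NumberTheory.EllipticCurves.ModularForms.IsNewformOf.tsum_normSq_cuspCoeff_div_rpow_le
    (hf : IsNewformOf W f) {w : ℝ} (hw : 2 < w) :
    ∑' n : ℕ, ‖cuspCoeff f n‖ ^ 2 / (n : ℝ) ^ w ≤ (∑' n : ℕ, 1 / (n : ℝ) ^ (w - 1)) ^ 4 := by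
  set Z : ℝ := ∑' n : ℕ, 1 / (n : ℝ) ^ (w - 1) with hZ
  set zl : Nat.Primes → ℝ := fun p ↦ (1 - (p : ℝ) ^ (-(w - 1)))⁻¹ with hzl
  have hw1 : 1 < w - 1 := by linarith
  have hZprod : HasProd zl Z := hasProd_one_sub_prime_rpow_neg_inv hw1
  have hD := hf.1.hasProd_tsum_normSq_cuspCoeff_prime_pow hw
  -- the local factors, in the `(p^{-w})^e` form
  set loc : Nat.Primes → ℝ := fun p ↦ ∑' e : ℕ, ‖cuspCoeff f ((p : ℕ) ^ e)‖ ^ 2 * (((p : ℕ) : ℝ) ^ (-w)) ^ e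
    with hloc
  have hloc_eq : ∀ p : Nat.Primes,
      (∑' e : ℕ, ‖cuspCoeff f ((p : ℕ) ^ e)‖ ^ 2 / ((((p : ℕ) ^ e : ℕ)) : ℝ) ^ w) = loc p := by
    intro p
    exact tsum_congr fun e ↦ normSq_cuspCoeff_prime_pow_div_eq f p e w
  have hfun : (fun p : Nat.Primes ↦
      ∑' e : ℕ, ‖cuspCoeff f ((p : ℕ) ^ e)‖ ^ 2 / ((((p : ℕ) ^ e : ℕ)) : ℝ) ^ w) = loc :=
    funext hloc_eq
  rw [hfun] at hD
  -- pointwise: `0 ≤ loc p ≤ (zl p)^4`, `1 ≤ zl p`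
  have hzl_pos : ∀ p : Nat.Primes, 0 < 1 - ((p : ℕ) : ℝ) ^ (-(w - 1)) := by
    intro p
    have hp1 : (1 : ℝ) < (p : ℕ) := by exact_mod_cast p.prop.one_lt
    have : ((p : ℕ) : ℝ) ^ (-(w - 1)) < 1 := Real.rpow_lt_one_of_one_lt_of_neg hp1 (by linarith)
    linarith
  have hzl_one : ∀ p : Nat.Primes, 1 ≤ zl p := by
    intro p
    have hp0 : (0 : ℝ) < (p : ℕ) := by exact_mod_cast p.prop.pos
    rw [hzl, one_le_inv₀ (hzl_pos p)]
    linarith [Real.rpow_nonneg hp0.le (-(w - 1))]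
  have hloc_nonneg : ∀ p : Nat.Primes, 0 ≤ loc p := fun p ↦
    tsum_nonneg fun e ↦ by positivity
  have hloc_le : ∀ p : Nat.Primes, loc p ≤ zl p ^ 4 := by
    intro p
    have h := hf.tsum_normSq_cuspCoeff_prime_pow_le hw p.prop
    rw [hzl, inv_pow, ← one_div]
    exact h
  -- partial products of `zl` are `≤ Z`
  have hZt : Tendsto (fun T : Finset Nat.Primes ↦ ∏ p ∈ T, zl p) atTop (𝓝 Z) := hZprod
  have hpartial : ∀ S : Finset Nat.Primes, ∏ p ∈ S, zl p ≤ Z := by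
    intro S
    refine ge_of_tendsto hZt (Filter.eventually_atTop.2 ⟨S, fun T hST ↦ ?_⟩)
    exact Finset.prod_le_prod_of_subset_of_one_le hST
      (fun p _ ↦ zero_le_one.trans (hzl_one p)) (fun p _ _ ↦ hzl_one p)
  refine hasProd_le_of_prod_le hD fun S ↦ ?_
  calc ∏ p ∈ S, loc p ≤ ∏ p ∈ S, zl p ^ 4 :=
        Finset.prod_le_prod (fun p _ ↦ hloc_nonneg p) (fun p _ ↦ hloc_le p)
    _ = (∏ p ∈ S, zl p) ^ 4 := Finset.prod_pow S 4 zl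
    _ ≤ Z ^ 4 := pow_le_pow_left₀ (Finset.prod_nonneg fun p _ ↦ zero_le_one.trans (hzl_one p))
        (hpartial S) 4

/-- The real zeta series is bounded by its pole: `Σ_{n ≥ 1} n^{-σ} ≤ σ/(σ − 1) + 1` for `σ > 1`
(the tree's `‖ζ(s)‖ ≤ ‖s‖/‖s−1‖ + ‖s‖/Re s`, `ZetaFractionalPartIntegral`). [folklore] -/
theorem tsum_one_div_nat_rpow_le {σ : ℝ} (hσ : 1 < σ) :
    ∑' n : ℕ, 1 / (n : ℝ) ^ σ ≤ σ / (σ - 1) + 1 := by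
  have hσ1 : (σ : ℂ) ≠ 1 := by
    intro h; have := congrArg Complex.re h; simp at this; linarith
  have h := norm_riemannZeta_le_of_re_pos (s := (σ : ℂ)) (by simp; linarith) hσ1
  rw [riemannZeta_ofReal_eq_tsum hσ, Complex.norm_real, show (σ : ℂ) - 1 = ((σ - 1 : ℝ) : ℂ) by
    push_cast; ring, Complex.norm_real, Complex.norm_real, Complex.ofReal_re,
    Real.norm_of_nonneg (by linarith : 0 ≤ σ), Real.norm_of_nonneg (by linarith : 0 ≤ σ - 1),
    div_self (by linarith : σ ≠ 0)] at h
  exact (Real.le_norm_self _).trans h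

/-- `Σ_{c ∣ N} c^{-σ} ≤ Σ_{n ≥ 1} n^{-σ}` (`σ > 1`), in the complex form
`‖Σ_{c ∣ N} c^{-s}‖ ≤ ζ(Re s)` used on the line `Re s = 1 + δ`. [folklore] -/
theorem norm_sum_divisors_cpow_neg_le (N : ℕ) {s : ℂ} (hs : 1 < s.re) :
    ‖∑ c ∈ N.divisors, (c : ℂ) ^ (-s)‖ ≤ ∑' n : ℕ, 1 / (n : ℝ) ^ s.re := by
  have hsum : Summable fun n : ℕ ↦ 1 / (n : ℝ) ^ s.re := Real.summable_one_div_nat_rpow.mpr hs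
  calc ‖∑ c ∈ N.divisors, (c : ℂ) ^ (-s)‖ ≤ ∑ c ∈ N.divisors, ‖(c : ℂ) ^ (-s)‖ := norm_sum_le _ _
    _ = ∑ c ∈ N.divisors, 1 / (c : ℝ) ^ s.re := by
        refine Finset.sum_congr rfl fun c hc ↦ ?_
        have hc0 : 0 < c := Nat.pos_of_mem_divisors hc
        rw [Complex.norm_natCast_cpow_of_pos hc0, Complex.neg_re, Real.rpow_neg (Nat.cast_nonneg c),
          one_div]
    _ ≤ ∑' n : ℕ, 1 / (n : ℝ) ^ s.re := hsum.sum_le_tsum _ fun n _ ↦ by positivity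

/-- `‖Σ |aₙ|² n^{-s}‖ ≤ Σ |aₙ|² n^{-Re s}` for `Re s > 2` (`f ∈ S₂(Γ₀(N))`). [folklore] -/
theorem norm_LSeries_normSq_cuspCoeff_le (f : CuspForm (Gamma0 N) 2) {s : ℂ} (hs : 2 < s.re) :
    ‖LSeries (fun n ↦ (((‖cuspCoeff f n‖ ^ 2 : ℝ)) : ℂ)) s‖ ≤
      ∑' n : ℕ, ‖cuspCoeff f n‖ ^ 2 / (n : ℝ) ^ s.re := by
  have hS := LSeriesSummable_normSq_cuspCoeff f hs
  have hnorm : ∀ n : ℕ, ‖LSeries.term (fun n ↦ (((‖cuspCoeff f n‖ ^ 2 : ℝ)) : ℂ)) s n‖ =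
      ‖cuspCoeff f n‖ ^ 2 / (n : ℝ) ^ s.re := by
    intro n
    rw [LSeries.norm_term_eq]
    rcases eq_or_ne n 0 with rfl | hn
    · simp [Real.zero_rpow (by linarith : s.re ≠ 0)]
    · rw [if_neg hn, Complex.norm_real, Real.norm_of_nonneg (sq_nonneg _)]
  have hS' : Summable fun n ↦ ‖LSeries.term (fun n ↦ (((‖cuspCoeff f n‖ ^ 2 : ℝ)) : ℂ)) s n‖ :=
    hS.norm
  calc ‖LSeries (fun n ↦ (((‖cuspCoeff f n‖ ^ 2 : ℝ)) : ℂ)) s‖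
      ≤ ∑' n, ‖LSeries.term (fun n ↦ (((‖cuspCoeff f n‖ ^ 2 : ℝ)) : ℂ)) s n‖ := norm_tsum_le_tsum_norm hS'
    _ = ∑' n : ℕ, ‖cuspCoeff f n‖ ^ 2 / (n : ℝ) ^ s.re := tsum_congr hnorm

end Arithmetic

/-! ### 2. Elementary bounds on the lines `Re s = 1 + δ` and `Re s = −δ` -/

section Lines

/-- `‖s‖ ≤ ‖s + 2‖` for `Re s ≥ −1`. [folklore] -/
theorem norm_le_norm_add_two {s : ℂ} (hs : -1 ≤ s.re) : ‖s‖ ≤ ‖s + 2‖ := by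
  rw [← sq_le_sq₀ (norm_nonneg _) (norm_nonneg _), Complex.sq_norm, Complex.sq_norm,
    Complex.normSq_apply, Complex.normSq_apply]
  simp only [Complex.add_re, Complex.add_im, Complex.re_ofNat, Complex.im_ofNat]
  nlinarith

/-- `‖s − 1‖ ≤ ‖s + 2‖` for `Re s ≥ −1/2`. [folklore] -/
theorem norm_sub_one_le_norm_add_two {s : ℂ} (hs : -1 / 2 ≤ s.re) : ‖s - 1‖ ≤ ‖s + 2‖ := by
  rw [← sq_le_sq₀ (norm_nonneg _) (norm_nonneg _), Complex.sq_norm, Complex.sq_norm,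
    Complex.normSq_apply, Complex.normSq_apply]
  simp only [Complex.add_re, Complex.add_im, Complex.sub_re, Complex.sub_im, Complex.re_ofNat,
    Complex.im_ofNat, Complex.one_re, Complex.one_im]
  nlinarith

/-- `‖3 − s‖ ≤ (7/3) ‖s + 2‖ for `Re s ≥ −1/2` (the reflection `s ↦ 1 − s` moves the line
`Re s = −δ`, `δ ≤ 1/2`, to `Re s = 1 + δ`; equality at `s = −1/2`). [folklore] -/
theorem norm_three_sub_le {s : ℂ} (hs : -1 / 2 ≤ s.re) :
    ‖3 - s‖ ≤ 7 / 3 * ‖s + 2‖ := by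
  have h73 : (0 : ℝ) ≤ 7 / 3 * ‖s + 2‖ := by positivity
  rw [← sq_le_sq₀ (norm_nonneg _) h73, mul_pow, Complex.sq_norm, Complex.sq_norm,
    Complex.normSq_apply, Complex.normSq_apply]
  simp only [Complex.add_re, Complex.add_im, Complex.sub_re, Complex.sub_im, Complex.re_ofNat,
    Complex.im_ofNat]
  nlinarith [sq_nonneg s.im]

/-- `‖Γ(s)‖ ≤ 1` for `1 ≤ Re s ≤ 2` (`‖Γ(s)‖ ≤ Γ(Re s)`, the tree's `norm_Gamma_le_Gamma_re`, and
`Γ ≤ 1` on `[1, 2]` by convexity, `Γ(1) = Γ(2) = 1`). [folklore] -/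
theorem norm_Gamma_le_one {s : ℂ} (hs1 : 1 ≤ s.re) (hs2 : s.re ≤ 2) : ‖Complex.Gamma s‖ ≤ 1 := by
  have h := Literature.Analysis.SpecialFunctions.GammaVert.norm_Gamma_le_Gamma_re
    (x := s.re) (by linarith) s.im
  rw [Complex.re_add_im] at h
  refine h.trans ?_
  have hc := Real.convexOn_Gamma.le_max_of_mem_Icc (x := 1) (y := 2) (z := s.re)
    (by simp) (by simp) ⟨hs1, hs2⟩
  rwa [Real.Gamma_one, Real.Gamma_two, max_self] at hc

/-- `‖ζ(2s)‖ ≤ 2 + ‖s‖` for `Re s ≥ 1` (from the tree's `‖ζ(z)‖ ≤ ‖z‖/‖z−1‖ + ‖z‖/Re z`: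
`‖2s‖ ≤ 2‖2s − 1‖` as `Re (2s − 1) ≥ 1`, and `‖2s‖/(2 Re s) ≤ ‖s‖`). [folklore] -/
theorem norm_riemannZeta_two_mul_le {s : ℂ} (hs : 1 ≤ s.re) : ‖riemannZeta (2 * s)‖ ≤ 2 + ‖s‖ := by
  have h2re : (2 * s).re = 2 * s.re := by simp
  have hne : 2 * s ≠ 1 := by
    intro h; have := congrArg Complex.re h; rw [h2re, Complex.one_re] at this; linarith
  have h := norm_riemannZeta_le_of_re_pos (s := 2 * s) (by rw [h2re]; linarith) hne
  have hn2 : ‖2 * s‖ = 2 * ‖s‖ := by rw [norm_mul, Complex.norm_ofNat]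
  -- `‖2s − 1‖ ≥ 1` and `‖2s − 1‖ ≥ ‖2s‖ − 1`
  have hge1 : 1 ≤ ‖2 * s - 1‖ := by
    have := Complex.re_le_norm (2 * s - 1)
    rw [Complex.sub_re, h2re, Complex.one_re] at this
    linarith
  have hge2 : ‖2 * s‖ - 1 ≤ ‖2 * s - 1‖ := by
    have := norm_sub_norm_le (2 * s) 1
    rw [norm_one] at this
    linarith [abs_sub_abs_le_abs_sub ‖2 * s‖ ‖(1 : ℂ)‖, norm_sub_le_norm_sub_add_norm_sub (2 * s) 0 1]
  have hA : ‖2 * s‖ / ‖2 * s - 1‖ ≤ 2 := by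
    rw [div_le_iff₀ (by linarith)]
    linarith
  have hB : ‖2 * s‖ / (2 * s).re ≤ ‖s‖ := by
    rw [h2re, hn2, div_le_iff₀ (by linarith)]
    nlinarith [norm_nonneg s]
  linarith

/-- `‖(x : ℂ)^{-s}‖ ≤ 1` for real `x ≥ 1` and `Re s ≥ 0`. [folklore] -/
theorem norm_ofReal_cpow_neg_le_one {x : ℝ} (hx : 1 ≤ x) {s : ℂ} (hs : 0 ≤ s.re) :
    ‖(x : ℂ) ^ (-s)‖ ≤ 1 := by
  rw [Complex.norm_cpow_eq_rpow_re_of_pos (by linarith) (-s), Complex.neg_re]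
  exact Real.rpow_le_one_of_one_le_of_nonpos hx (by linarith)

/-- `‖(4π/N)^{-(s+1)}‖ ≤ N · N^{Re s}` for `Re s ≥ −1` (`= (N/(4π))^{Re s + 1}`, `4π ≥ 1`). [folklore] -/
theorem norm_cpow_level_le {N : ℕ} (hN : 0 < N) {s : ℂ} (hs : -1 ≤ s.re) :
    ‖(((4 * Real.pi / N : ℝ)) : ℂ) ^ (-(s + 1))‖ ≤ N * (N : ℝ) ^ s.re := by
  have hN0 : (0 : ℝ) < N := by exact_mod_cast hN
  have h4π : (1 : ℝ) ≤ 4 * π := by linarith [Real.pi_gt_three]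
  have ha : (0 : ℝ) < 4 * π / N := by positivity
  rw [Complex.norm_cpow_eq_rpow_re_of_pos ha, Complex.neg_re, Complex.add_re, Complex.one_re,
    Real.rpow_neg ha.le, ← Real.inv_rpow ha.le, inv_div]
  calc (N / (4 * π) : ℝ) ^ (s.re + 1) ≤ (N : ℝ) ^ (s.re + 1) := by
        refine Real.rpow_le_rpow (by positivity) ?_ (by linarith)
        rw [div_le_iff₀ (by positivity)]
        nlinarith
    _ = N * (N : ℝ) ^ s.re := by rw [Real.rpow_add hN0, Real.rpow_one, mul_comm]

end Lines

/-! ### 3. The Phragmén–Lindelöf bound for the completed trace zeta function and the theorem -/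

section Main

/-- Polynomial growth in the strip is of finite order: `(2 + t)² ≤ 4 e^t` for `t ≥ 0`. [folklore] -/
theorem two_add_sq_le_four_mul_exp {t : ℝ} (ht : 0 ≤ t) : (2 + t) ^ 2 ≤ 4 * Real.exp t := by
  have h := Real.quadratic_le_exp_of_nonneg ht
  nlinarith

/-- **The Petersson norm of the newform of a semistable elliptic curve is `≪ N (log N)⁵`.** There is
an absolute constant `C > 0` such that for every squarefree `N ≥ 1`, every elliptic curve `E/ℚ`
(a `WeierstrassCurve ℚ` with `IsElliptic`) and every `f ∈ S₂(Γ₀(N))` with `IsNewformOf E f`,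

  `Re (f, f)_{Γ₀(N)} ≤ C · N · (1 + log N)⁵`.

This is the upper half of Mai–Murty's Proposition (`log⟨f,f⟩ = O(log N)`; [MaiMurty1994], §2;
quoted as "`‖f‖² ≪ N log N`" in [MurtyCongruencePrimes1999], §2 and [PastenShimura2024], p. 49 —
see the caveat on `murty_petersson_newform_upper_bound`) for semistable curves, by the printed
method — the Phragmén–Lindelöf principle for the Rankin–Selberg (symmetric-square) `L`-function of
`f` in the level aspect — carried out on the tree's continuation: with `G_f` the `SL₂(ℤ)`-trace of
`|f|²y²`, `V = ∫_𝒟 G_f dμ = Re (f,f)` and `Z_f(s) = s(s−1)∫_𝒟 G_f E₀*(·,s) dμ + V/2` (entire,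
`Z_f(1−s) = Z_f(s)`, `Z_f(1) = V/2`, `|Z_f(s)| ≤ (|s(s−1)|Q(1+N/4π)⁴ + ½)V` on `−1/2 ≤ Re s ≤ 7/2`:
`RankinSelbergContinuationSL2`, `RankinSelbergUniformBoundSL2`), one has for squarefree `N` and
`Re s > 1` (`IsNewform0.traceZeta_eq_of_squarefree`)
`Z_f(s) = s(s−1)π^{-s}Γ(s)ζ(2s)Γ(s+1)(4π/N)^{-(s+1)} (N⁻¹Σ_{c∣N}c^{-s}) Σ|aₙ|²n^{-(s+1)}`, whence
on `Re s = 1 + δ` (`0 < δ ≤ 1/2`), by Hasse's bound in the form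
`Σ|aₙ|²n^{-(2+δ)} ≤ ζ(1+δ)⁴` (`IsNewformOf.tsum_normSq_cuspCoeff_div_rpow_le`) and
`Σ_{c∣N}c^{-1-δ} ≤ ζ(1+δ)`, `|Z_f(s)| ≤ 2N^{1+δ}ζ(1+δ)⁵ |s+2|⁴`; the same on `Re s = −δ` up to the
factor `(7/3)⁴` by the functional equation; Rademacher's Phragmén–Lindelöf theorem
(`rademacher_phragmenLindelof_of_finiteOrder`) then gives `V/2 = Z_f(1) ≤ 81·(7/3)⁴·2N^{1+δ}ζ(1+δ)⁵`,
and `δ = 1/(2 + log N)` (`N^δ ≤ e`, `ζ(1+δ) ≤ 2 + 1/δ = 4 + log N`) yields the claim with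
`C = 324 · (7/3)⁴ · e · 4⁵`. The exponent `5` (instead of Mai–Murty's `3`, from Shimura's
holomorphy of `L(s, Sym² f)` itself) is the price of bounding `ζ(2s)(Σ_{c∣N}c^{-s})Σ|aₙ|²n^{-s-1}`
rather than `ζ(s)L(Sym² f, s+1)` on the right-hand line; the restriction to squarefree `N` is that
of the tree's Rankin–Selberg dictionary (for `p² ∣ N` the trace picks up the other cusps' twists).
[cite: MaiMurty1994, §2 (Proposition: log⟨f,f⟩ = O(log N), by Rademacher's Phragmén–Lindelöf theorem)] -/
theorem exists_petersson_le_mul_log_pow_of_squarefree :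
    ∃ C : ℝ, 0 < C ∧ ∀ (N : ℕ) [NeZero N], Squarefree N →
      ∀ (W : WeierstrassCurve ℚ) [W.IsElliptic] (f : CuspForm (Gamma0 N) 2), IsNewformOf W f →
        (peterssonProduct (Gamma0 N) 2 f f).re ≤ C * N * (1 + Real.log N) ^ 5 := by
  obtain ⟨Q, hQ, hQbd⟩ := exists_norm_J₀_le_uniform
  refine ⟨324 * (7 / 3) ^ 4 * Real.exp 1 * 4 ^ 5, by positivity, ?_⟩
  intro N _ hN W _ f hf
  have hπ := Real.pi_pos
  have hN0 : (0 : ℝ) < N := Nat.cast_pos.mpr (NeZero.pos N)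
  have hN1 : (1 : ℝ) ≤ N := by exact_mod_cast NeZero.one_le
  have hlogN : 0 ≤ Real.log N := Real.log_nonneg hN1
  -- the horocycle datum of the trace `G_f` (as in `NewformPeterssonSizeSiegelProofs`)
  have hGc : Continuous (rsTrace N 2 f) := continuous_rsTrace (ModularFormClass.continuous f)
  have hGinv : ∀ (A : SL(2, ℤ)) (τ : UpperHalfPlane), rsTrace N 2 f (A • τ) = rsTrace N 2 f τ :=
    fun A τ ↦ rsTrace_smul f A τ
  have hG0 : ∀ τ, 0 ≤ rsTrace N 2 f τ := fun τ ↦ rsTrace_nonneg _ τ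
  obtain ⟨B, -, hB⟩ := exists_rsTrace_le f
  have hC : ∀ n, 0 ≤ rsCoeff N 2 f n := fun n ↦ rsCoeff_nonneg _ n
  have hC0 : rsCoeff N 2 f 0 = 0 := rsCoeff_zero f
  set a : ℝ := 4 * π / N with hadef
  have ha : 0 < a := by positivity
  have hs : ∀ y : ℝ, 0 < y → Summable fun n : ℕ ↦ rsCoeff N 2 f n * Real.exp (-a * n * y) :=
    fun y hy ↦ summable_rsCoeff_mul_exp_datum f hy
  have hm : ∀ y : ℝ, 0 < y → ∫ x in (0 : ℝ)..1, rsTrace N 2 f (pt x y) =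
      y ^ (2 : ℝ) * ∑' n : ℕ, rsCoeff N 2 f n * Real.exp (-a * n * y) :=
    fun y hy ↦ horocycle_rsTrace_datum f hy
  have hκ : (0 : ℝ) ≤ 2 := by norm_num
  -- `J`, `V`, `Z`
  set J : ℂ → ℂ := fun s ↦ ∫ w in ModularGroup.fd, (rsTrace N 2 f w : ℂ) * completedEisenstein₀ w s
    with hJdef
  set V : ℝ := ∫ w in ModularGroup.fd, rsTrace N 2 f w with hVdef
  have hVeq : (peterssonProduct (Gamma0 N) 2 f f).re = V :=
    peterssonProduct_self_re_eq_integral_rsTrace f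
  have hV0 : 0 ≤ V := setIntegral_nonneg ModularGroup.isClosed_fd.measurableSet fun w _ ↦ hG0 w
  have hJ : Differentiable ℂ J := differentiable_J₀ hGc hGinv hG0 hB hC hC0 ha hκ hs hm
  have hJbd : ∀ s : ℂ, -1 / 2 ≤ s.re → s.re ≤ 7 / 2 → ‖J s‖ ≤ Q * (1 + a⁻¹) ^ 4 * V :=
    fun s h1 h2 ↦ hQbd hGc hGinv hG0 hB hC hC0 ha hs hm h1 h2
  set M : ℝ := Q * (1 + a⁻¹) ^ 4 * V with hMdef
  have hM0 : 0 ≤ M := by positivity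
  set Z : ℂ → ℂ := fun s ↦ s * (s - 1) * J s + (V : ℂ) / 2 with hZdef
  have hZdiff : Differentiable ℂ Z :=
    ((differentiable_id.mul (differentiable_id.sub_const 1)).mul hJ).add_const _
  have hZsymm : ∀ s : ℂ, Z (1 - s) = Z s := by
    intro s
    have hJs : J (1 - s) = J s := J₀_one_sub (fun w ↦ rsTrace N 2 f w) s
    show (1 - s) * (1 - s - 1) * J (1 - s) + (V : ℂ) / 2 = s * (s - 1) * J s + (V : ℂ) / 2
    rw [hJs]; ring
  have hZone : Z 1 = (V : ℂ) / 2 := by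
    show (1 : ℂ) * (1 - 1) * J 1 + (V : ℂ) / 2 = (V : ℂ) / 2
    ring
  -- finite order in the strip `-1/2 ≤ Re s ≤ 3/2`
  have hgrowth : ∀ z : ℂ, -1 / 2 ≤ z.re → z.re ≤ 3 / 2 →
      ‖Z z‖ ≤ (4 * M + V / 2) * Real.exp (|z.im| ^ (1 : ℝ)) := by
    intro z hz1 hz2
    rw [Real.rpow_one]
    have hz : ‖z‖ ≤ 2 + |z.im| := by
      have := Complex.norm_le_abs_re_add_abs_im z
      have : |z.re| ≤ 2 := abs_le.2 ⟨by linarith, by linarith⟩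
      linarith
    have hz' : ‖z - 1‖ ≤ 2 + |z.im| := by
      have := Complex.norm_le_abs_re_add_abs_im (z - 1)
      rw [Complex.sub_re, Complex.sub_im, Complex.one_re, Complex.one_im, sub_zero] at this
      have : |z.re - 1| ≤ 2 := abs_le.2 ⟨by linarith, by linarith⟩
      linarith
    have hexp := two_add_sq_le_four_mul_exp (abs_nonneg z.im)
    have h1e : 1 ≤ Real.exp |z.im| := Real.one_le_exp (abs_nonneg _)
    have hVn : ‖(V : ℂ) / 2‖ = V / 2 := by
      rw [norm_div, Complex.norm_real, Complex.norm_ofNat, Real.norm_of_nonneg hV0]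
    calc ‖Z z‖ = ‖z * (z - 1) * J z + (V : ℂ) / 2‖ := rfl
      _ ≤ ‖z * (z - 1) * J z‖ + ‖(V : ℂ) / 2‖ := norm_add_le _ _
      _ = ‖z‖ * ‖z - 1‖ * ‖J z‖ + V / 2 := by rw [norm_mul, norm_mul, hVn]
      _ ≤ (2 + |z.im|) * (2 + |z.im|) * M + V / 2 * 1 := by
          rw [mul_one]
          have hJz : ‖J z‖ ≤ M := hJbd z hz1 (by linarith)
          have h1 : ‖z‖ * ‖z - 1‖ ≤ (2 + |z.im|) * (2 + |z.im|) :=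
            mul_le_mul hz hz' (norm_nonneg _) (by positivity)
          have h2 : ‖z‖ * ‖z - 1‖ * ‖J z‖ ≤ (2 + |z.im|) * (2 + |z.im|) * M :=
            mul_le_mul h1 hJz (norm_nonneg _) (by positivity)
          linarith
      _ ≤ (4 * Real.exp |z.im|) * M + V / 2 * Real.exp |z.im| := by
          have h3 : (2 + |z.im|) * (2 + |z.im|) ≤ 4 * Real.exp |z.im| := by rw [← sq]; exact hexp
          have h4 : (2 + |z.im|) * (2 + |z.im|) * M ≤ 4 * Real.exp |z.im| * M :=
            mul_le_mul_of_nonneg_right h3 hM0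
          have h5 : V / 2 * 1 ≤ V / 2 * Real.exp |z.im| := mul_le_mul_of_nonneg_left h1e (by linarith)
          linarith
      _ = (4 * M + V / 2) * Real.exp |z.im| := by ring
  -- the parameter `δ` and the real zeta value `ζ(1 + δ)`
  set δ : ℝ := 1 / (2 + Real.log N) with hδdef
  have hδ0 : 0 < δ := by positivity
  have hδhalf : δ ≤ 1 / 2 := by
    rw [hδdef]; exact one_div_le_one_div_of_le (by norm_num) (by linarith)
  set ζδ : ℝ := ∑' n : ℕ, 1 / (n : ℝ) ^ (1 + δ) with hζδdef
  have hζδpos : 0 < ζδ := tsum_one_div_nat_rpow_pos (by linarith)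
  have hζδle : ζδ ≤ 4 + Real.log N := by
    have h := tsum_one_div_nat_rpow_le (σ := 1 + δ) (by linarith)
    have hδne : δ ≠ 0 := hδ0.ne'
    have e1 : (1 + δ) / (1 + δ - 1) + 1 = 2 + 1 / δ := by
      rw [show (1 : ℝ) + δ - 1 = δ by ring]; field_simp; ring
    have e2 : 1 / δ = 2 + Real.log N := by rw [hδdef, one_div_one_div]
    linarith
  have hNδ : (N : ℝ) ^ δ ≤ Real.exp 1 := by
    rw [Real.rpow_def_of_pos hN0]
    refine Real.exp_le_exp.2 ?_
    rw [hδdef, mul_one_div]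
    exact div_le_one_of_le₀ (by linarith) (by linarith)
  -- the bound on the line `Re s = 1 + δ`
  set A₀ : ℝ := 2 * (N * (N : ℝ) ^ δ) * ζδ ^ 5 with hA₀def
  have hA₀pos : 0 < A₀ := by positivity
  have hright : ∀ z : ℂ, z.re = 1 + δ → ‖Z z‖ ≤ A₀ * ‖z + 2‖ ^ 4 := by
    intro z hz
    have hz1 : 1 < z.re := by rw [hz]; linarith
    have hZeq : Z z = z * (z - 1) * ((π : ℂ) ^ (-z) * Complex.Gamma z * riemannZeta (2 * z) *
          (Complex.Gamma (z + 1) * (((4 * π / N : ℝ)) : ℂ) ^ (-(z + 1)))) *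
        (((N : ℂ)⁻¹ * ∑ c ∈ N.divisors, (c : ℂ) ^ (-z)) *
          LSeries (fun n ↦ (((‖cuspCoeff f n‖ ^ 2 : ℝ)) : ℂ)) (z + 1)) :=
      hf.1.traceZeta_eq_of_squarefree hN hz1
    -- the factors
    have b1 : ‖z‖ ≤ ‖z + 2‖ := norm_le_norm_add_two (by linarith)
    have b2 : ‖z - 1‖ ≤ ‖z + 2‖ := norm_sub_one_le_norm_add_two (by linarith)
    have b3 : ‖(π : ℂ) ^ (-z)‖ ≤ 1 :=
      norm_ofReal_cpow_neg_le_one (by linarith [Real.pi_gt_three]) (by linarith)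
    have b4 : ‖Complex.Gamma z‖ ≤ 1 := norm_Gamma_le_one (by linarith) (by linarith)
    have b5 : ‖riemannZeta (2 * z)‖ ≤ 2 * ‖z + 2‖ := by
      have h := norm_riemannZeta_two_mul_le (s := z) (by linarith)
      have h3 : (3 : ℝ) ≤ ‖z + 2‖ := by
        have := Complex.re_le_norm (z + 2)
        rw [Complex.add_re, Complex.re_ofNat] at this
        linarith
      linarith
    have b6 : ‖Complex.Gamma (z + 1)‖ ≤ ‖z + 2‖ := by
      have hz0 : z ≠ 0 := fun h ↦ by rw [h, Complex.zero_re] at hz1; linarith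
      rw [Complex.Gamma_add_one z hz0, norm_mul]
      calc ‖z‖ * ‖Complex.Gamma z‖ ≤ ‖z + 2‖ * 1 := by gcongr
        _ = ‖z + 2‖ := mul_one _
    have b7 : ‖(((4 * π / N : ℝ)) : ℂ) ^ (-(z + 1))‖ ≤ N * (N * (N : ℝ) ^ δ) := by
      have h := norm_cpow_level_le (NeZero.pos N) (s := z) (by linarith)
      rw [hz, Real.rpow_add hN0, Real.rpow_one] at h
      exact h
    have b8 : ‖(N : ℂ)⁻¹‖ = (N : ℝ)⁻¹ := by rw [norm_inv, Complex.norm_natCast]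
    have b9 : ‖∑ c ∈ N.divisors, (c : ℂ) ^ (-z)‖ ≤ ζδ := by
      have h := norm_sum_divisors_cpow_neg_le N hz1
      rwa [hz] at h
    have b10 : ‖LSeries (fun n ↦ (((‖cuspCoeff f n‖ ^ 2 : ℝ)) : ℂ)) (z + 1)‖ ≤ ζδ ^ 4 := by
      have hz2 : 2 < (z + 1).re := by simp; linarith
      refine (norm_LSeries_normSq_cuspCoeff_le f hz2).trans ?_
      have h := hf.tsum_normSq_cuspCoeff_div_rpow_le (w := (z + 1).re) hz2
      have e : (z + 1).re - 1 = 1 + δ := by simp [hz]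
      rwa [e] at h
    calc ‖Z z‖ = ‖z‖ * ‖z - 1‖ * (‖(π : ℂ) ^ (-z)‖ * ‖Complex.Gamma z‖ * ‖riemannZeta (2 * z)‖ *
          (‖Complex.Gamma (z + 1)‖ * ‖(((4 * π / N : ℝ)) : ℂ) ^ (-(z + 1))‖)) *
        ((‖(N : ℂ)⁻¹‖ * ‖∑ c ∈ N.divisors, (c : ℂ) ^ (-z)‖) *
          ‖LSeries (fun n ↦ (((‖cuspCoeff f n‖ ^ 2 : ℝ)) : ℂ)) (z + 1)‖) := by
          rw [hZeq]; simp only [norm_mul]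
      _ ≤ ‖z + 2‖ * ‖z + 2‖ * (1 * 1 * (2 * ‖z + 2‖) * (‖z + 2‖ * (N * (N * (N : ℝ) ^ δ)))) *
        (((N : ℝ)⁻¹ * ζδ) * ζδ ^ 4) := by
          rw [b8]
          gcongr
      _ = A₀ * ‖z + 2‖ ^ 4 := by
          rw [hA₀def]
          field_simp
  -- the bound on both lines, with `A = (7/3)⁴ A₀`
  set A : ℝ := (7 / 3) ^ 4 * A₀ with hAdef
  have hApos : 0 < A := by positivity
  have hA₀A : A₀ ≤ A := by
    rw [hAdef]
    have : (1 : ℝ) ≤ (7 / 3) ^ 4 := by norm_num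
    nlinarith
  have hb : ∀ z : ℂ, z.re = 1 + δ → ‖Z z‖ ≤ A * ‖(2 : ℂ) + z‖ ^ (4 : ℝ) := by
    intro z hz
    rw [show (4 : ℝ) = (4 : ℕ) by norm_num, Real.rpow_natCast, add_comm (2 : ℂ) z]
    exact (hright z hz).trans (mul_le_mul_of_nonneg_right hA₀A (by positivity))
  have ha' : ∀ z : ℂ, z.re = -δ → ‖Z z‖ ≤ A * ‖(2 : ℂ) + z‖ ^ (4 : ℝ) := by
    intro z hz
    rw [show (4 : ℝ) = (4 : ℕ) by norm_num, Real.rpow_natCast, add_comm (2 : ℂ) z]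
    have hsym : Z z = Z (1 - z) := by
      have := hZsymm (1 - z); rwa [sub_sub_cancel] at this
    have h1z : (1 - z).re = 1 + δ := by simp [hz]
    have h := hright (1 - z) h1z
    have h3 : ‖1 - z + 2‖ ≤ 7 / 3 * ‖z + 2‖ := by
      rw [show (1 : ℂ) - z + 2 = 3 - z by ring]
      exact norm_three_sub_le (by rw [hz]; linarith)
    rw [hsym]
    calc ‖Z (1 - z)‖ ≤ A₀ * ‖1 - z + 2‖ ^ 4 := h
      _ ≤ A₀ * (7 / 3 * ‖z + 2‖) ^ 4 := by gcongr
      _ = A * ‖z + 2‖ ^ 4 := by rw [hAdef]; ring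
  -- Phragmén–Lindelöf at `s = 1`
  have hgr : ∀ z : ℂ, -δ < z.re → z.re < 1 + δ →
      ‖Z z‖ ≤ (4 * M + V / 2) * Real.exp (|z.im| ^ (1 : ℝ)) :=
    fun z h1 h2 ↦ hgrowth z (by linarith) (by linarith)
  have hPL := Literature.Analysis.Complex.rademacher_phragmenLindelof_of_finiteOrder (f := Z) (a := -δ) (b := 1 + δ)
    (Q := 2) (A := A) (B := A) (α := 4) (β := 4) (C := 4 * M + V / 2) (c := 1)
    (by linarith) (by linarith) hApos hApos le_rfl hZdiff.diffContOnCl one_pos hgr ha' hb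
    (z := 1) (by simp; linarith) (by simp; linarith)
  -- `‖Z 1‖ ≤ 81 A`
  have h81 : ‖((2 : ℝ) : ℂ) + 1‖ ^ (4 : ℝ) = 81 := by
    rw [show ((2 : ℝ) : ℂ) + 1 = (3 : ℝ) by push_cast; norm_num, Complex.norm_real,
      Real.norm_of_nonneg (by norm_num : (0 : ℝ) ≤ 3), show (4 : ℝ) = (4 : ℕ) by norm_num,
      Real.rpow_natCast]
    norm_num
  have hx : 0 < A * 81 := by positivity
  have hZ1 : ‖Z 1‖ ≤ A * 81 := by
    rw [h81, Complex.one_re] at hPL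
    have e : (1 + δ - 1) / (1 + δ - -δ) + (1 - -δ) / (1 + δ - -δ) = 1 := by
      rw [← add_div, show (1 : ℝ) + δ - 1 + (1 - -δ) = 1 + δ - -δ by ring,
        div_self (by linarith : (1 : ℝ) + δ - -δ ≠ 0)]
    calc ‖Z 1‖ ≤ (A * 81) ^ ((1 + δ - 1) / (1 + δ - -δ)) * (A * 81) ^ ((1 - -δ) / (1 + δ - -δ)) := hPL
      _ = A * 81 := by rw [← Real.rpow_add hx, e, Real.rpow_one]
  -- conclusion
  have hV : V / 2 ≤ A * 81 := by
    have : ‖Z 1‖ = V / 2 := by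
      rw [hZone, norm_div, Complex.norm_real, Complex.norm_ofNat, Real.norm_of_nonneg hV0]
    rw [← this]; exact hZ1
  rw [hVeq]
  have hζ5 : ζδ ^ 5 ≤ (4 * (1 + Real.log N)) ^ 5 :=
    pow_le_pow_left₀ hζδpos.le (by linarith) 5
  calc V ≤ 2 * (A * 81) := by linarith
    _ = 324 * (7 / 3) ^ 4 * (N * (N : ℝ) ^ δ * ζδ ^ 5) := by rw [hAdef, hA₀def]; ring
    _ ≤ 324 * (7 / 3) ^ 4 * (N * Real.exp 1 * (4 * (1 + Real.log N)) ^ 5) := by gcongr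
    _ = 324 * (7 / 3) ^ 4 * Real.exp 1 * 4 ^ 5 * N * (1 + Real.log N) ^ 5 := by ring

/-- **The same bound in the shape of the named fact, exponent `5`**: an absolute `C > 0` with
`Re (f, f)_{Γ₀(N)} ≤ C · N · (log N)⁵` for every squarefree `N ≥ 3` and every newform `f` of an
elliptic curve over `ℚ` of level `N` (`1 + log N ≤ 2 log N` for `N ≥ 3 > e`). Compare
`murty_petersson_newform_upper_bound` (exponent `1`, all `N`: not known) and the statement its
cited proof gives (exponent `3`, all `N`: [MaiMurty1994], §2, through Shimura's holomorphy of
`L(s, Sym² f)`, not in the tree). [cite: MaiMurty1994, §2 (Proposition: log⟨f,f⟩ = O(log N))] -/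
theorem exists_petersson_le_mul_log_pow_five_of_squarefree :
    ∃ C : ℝ, 0 < C ∧ ∀ (N : ℕ) [NeZero N], Squarefree N → 3 ≤ N →
      ∀ (W : WeierstrassCurve ℚ) [W.IsElliptic] (f : CuspForm (Gamma0 N) 2), IsNewformOf W f →
        (peterssonProduct (Gamma0 N) 2 f f).re ≤ C * N * Real.log N ^ 5 := by
  obtain ⟨C, hC, h⟩ := exists_petersson_le_mul_log_pow_of_squarefree
  refine ⟨C * 2 ^ 5, by positivity, fun N _ hN hN3 W _ f hf ↦ ?_⟩
  have hN0 : (0 : ℝ) < N := Nat.cast_pos.mpr (NeZero.pos N)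
  have hN3' : (3 : ℝ) ≤ N := by exact_mod_cast hN3
  have hlog1 : 1 ≤ Real.log N := by
    rw [Real.le_log_iff_exp_le hN0]
    exact (Real.exp_one_lt_d9.le.trans (by norm_num)).trans hN3'
  have hle : 1 + Real.log N ≤ 2 * Real.log N := by linarith
  calc (peterssonProduct (Gamma0 N) 2 f f).re ≤ C * N * (1 + Real.log N) ^ 5 := h N hN W f hf
    _ ≤ C * N * (2 * Real.log N) ^ 5 := by gcongr
    _ = C * 2 ^ 5 * N * Real.log N ^ 5 := by ring

/-- **The logarithmic form used downstream**: an absolute `C` with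
`log Re (f, f)_{Γ₀(N)} ≤ log N + 5 log log N + C` for every squarefree `N ≥ 3` and every newform `f`
of an elliptic curve over `ℚ` of level `N` — Pasten's "`2 log ‖f‖ ≤ log N + O(log log N)`"
([PastenShimura2024], p. 49, proof of Thm. 16.1) and the upper half of Murty's
`(1−ε) log N < log (f,f) < (1+ε) log N` ([MurtyCongruencePrimes1999], §2), for semistable curves.
[cite: PastenShimura2024, §16 p. 49 (2 log ‖f‖ ≤ log N + O(log log N))] -/
theorem exists_log_petersson_le_of_squarefree :
    ∃ C : ℝ, ∀ (N : ℕ) [NeZero N], Squarefree N → 3 ≤ N →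
      ∀ (W : WeierstrassCurve ℚ) [W.IsElliptic] (f : CuspForm (Gamma0 N) 2), IsNewformOf W f →
        Real.log (peterssonProduct (Gamma0 N) 2 f f).re ≤
          Real.log N + 5 * Real.log (Real.log N) + C := by
  obtain ⟨C, hC, h⟩ := exists_petersson_le_mul_log_pow_five_of_squarefree
  refine ⟨Real.log C, fun N _ hN hN3 W _ f hf ↦ ?_⟩
  have hN0 : (0 : ℝ) < N := Nat.cast_pos.mpr (NeZero.pos N)
  have hN3' : (3 : ℝ) ≤ N := by exact_mod_cast hN3
  have hlog1 : 1 ≤ Real.log N := by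
    rw [Real.le_log_iff_exp_le hN0]
    exact (Real.exp_one_lt_d9.le.trans (by norm_num)).trans hN3'
  have hpos : 0 < (peterssonProduct (Gamma0 N) 2 f f).re := hf.peterssonProduct_re_pos
  have hb := h N hN hN3 W f hf
  have hlogpos : 0 < Real.log N := by linarith
  calc Real.log (peterssonProduct (Gamma0 N) 2 f f).re ≤ Real.log (C * N * Real.log N ^ 5) :=
        Real.log_le_log hpos hb
    _ = Real.log N + 5 * Real.log (Real.log N) + Real.log C := by
        rw [Real.log_mul (by positivity) (by positivity), Real.log_mul hC.ne' hN0.ne',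
          Real.log_pow]
        push_cast
        ring

end Main

end Literature.NumberTheory.Automorphic
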